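import Summits.RiemannHypothesis.RiemannHypothesis.Theorems.LiHeightLawLogDefs
import Summits.RiemannHypothesis.RiemannHypothesis.Theorems.LiCoefficientsLiFarZeroTail
import HarnessLib

/-!
# RiemannHypothesis / LiHeightLog — crux `LiCoshTailCount` (deciding; RH-FREE zero counting)

Route `RiemannHypothesis/LiHeightLog` (cell `pub/rh-li`, round 6, dossier `theory/route/r6/README-R6.md`),
item `LiCoshTailCount`: for `1000 ≤ T ≤ U` and every `n`,

  `∑_{T < Im ρ ≤ U} m(ρ) G_n(Im ρ) ≤ liCoshTail n T = (cosh(n/2T²) − 1)(T(log(T/2π) + 1)/π + 1.24 log T + 18)`,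

`G_n = liCoshWeight n` (Brown's modulus-defect weight), the sum running over the zeros of `ζ` in the closed
critical strip with ordinates in `(T, U]` (`SchoenfeldBound.zerosBetween`, multiplicities `riemannZetaZeroOrder`).
RH-FREE: nothing about the real parts of the zeros is used; PROOF-OF-DATA rung L-P(P1-log) of the RH ladder's
column LI; nothing here bears on the truth of RH.

Proof.  `G_n(t) = 2(cosh(n log r) − 1)`, `r = √(1 + t⁻²)`, `log r ≤ 1/(2t²)`, so `G_n ≤ 2φ`,
`φ(t) = cosh(n/2t²) − 1` (`liCoshWeight_le_two_mul_phi`).  Partial summation of the decreasing `C¹` weight `2φ`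
against the explicit two-sided zero count `N⁻ ≤ N ≤ N⁺`, `N^± = (t/2π) log(t/2πe) ± (0.3083 log t + 4.128)`
(`sum_zerosBetween_le_of_count_le`, `FarZeroTail.count_le_nUp4`, `FarZeroTail.nLo4_le_count`) gives
`∑ ≤ g(U)·2φ(U) + ∫_T^U g(t)(−2φ'(t)) dt`, `g = N⁺ − N⁻(T)`.  Instead of integrating by parts we exhibit a
POTENTIAL: with `P(t) = t(log(t/2π) + 1)/π + 0.3083` and `W = 2gφ + φP`, the elementary inequality
`cosh u − 1 ≤ u sinh u` (`u = n/2t² ≥ 0`; `cosh_sub_one_le_mul_sinh`) gives `g(−2φ') ≤ −W'` pointwise,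
because `−W' − 2g(−φ') = (−φ')P − φ(2g' + P') = 2B(u sinh u − φ)` with
`B = (log(t/2π) + 1)/π + 0.3083/t ≥ 0`, `P = tB`, `2g' + P' = 2B`.  Hence
`∑ ≤ g(U)2φ(U) + W(T) − W(U) ≤ W(T) = φ(T)[4(0.3083 log T + 4.128) + P(T)]`
`= φ(T)[T(log(T/2π)+1)/π + 1.2332 log T + 16.8203] ≤ liCoshTail n T`.
-/

noncomputable section

-- D-0017: `Summit.<S>.<S>.…` is the designed namespace of a single-problem summit.
set_option linter.dupNamespace false

open Real Set MeasureTheory intervalIntegral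
open scoped Real

namespace Summit.RiemannHypothesis.RiemannHypothesis.Theorems.LiTheory

open Literature.NumberTheory.LFunctions Literature.NumberTheory.LFunctions.SchoenfeldBound
open FarZeroTail

namespace CoshTail

/-! ### Elementary inequalities -/

/-- `cosh u − 1 ≤ u sinh u` for `u ≥ 0` (the function `u sinh u − cosh u` has derivative `u cosh u ≥ 0`). -/
theorem cosh_sub_one_le_mul_sinh {u : ℝ} (hu : 0 ≤ u) : Real.cosh u - 1 ≤ u * Real.sinh u := by
  have hderiv : ∀ x : ℝ,
      HasDerivAt (fun y => y * Real.sinh y - Real.cosh y) (x * Real.cosh x) x := by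
    intro x
    have h1 : HasDerivAt (fun y : ℝ => y * Real.sinh y) (1 * Real.sinh x + x * Real.cosh x) x :=
      (hasDerivAt_id x).mul (Real.hasDerivAt_sinh x)
    exact (h1.sub (Real.hasDerivAt_cosh x)).congr_deriv (by ring)
  have hmono : MonotoneOn (fun y => y * Real.sinh y - Real.cosh y) (Ici 0) := by
    refine monotoneOn_of_deriv_nonneg (convex_Ici 0) ?_ ?_ ?_
    · exact ((continuous_id.mul Real.continuous_sinh).sub Real.continuous_cosh).continuousOn
    · exact fun x _ => (hderiv x).differentiableAt.differentiableWithinAt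
    · intro x hx
      rw [interior_Ici] at hx
      rw [(hderiv x).deriv]
      exact mul_nonneg (le_of_lt hx) (Real.cosh_pos x).le
  have h := hmono (self_mem_Ici (a := (0 : ℝ))) (mem_Ici.2 hu) hu
  simp only [zero_mul, Real.cosh_zero, zero_sub] at h
  linarith

/-- `φ_n(t) = cosh(n/(2t²)) − 1 ≥ 0` (the majorant of half the modulus-defect weight). -/
theorem phi_nonneg (n : ℕ) (t : ℝ) : 0 ≤ Real.cosh (n / (2 * t ^ 2)) - 1 := by
  linarith [Real.one_le_cosh ((n : ℝ) / (2 * t ^ 2))]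

/-- `G_n(t) = 2(cosh(n log √(1 + 1/t²)) − 1)`. -/
theorem liCoshWeight_eq (n : ℕ) (t : ℝ) :
    liCoshWeight n t = 2 * (Real.cosh (n * Real.log (Real.sqrt (1 + 1 / t ^ 2))) - 1) := by
  have h0 : 0 < Real.sqrt (1 + 1 / t ^ 2) := Real.sqrt_pos.2 (by positivity)
  have hpow : Real.sqrt (1 + 1 / t ^ 2) ^ n = Real.exp (n * Real.log (Real.sqrt (1 + 1 / t ^ 2))) := by
    rw [Real.exp_nat_mul, Real.exp_log h0]
  rw [liCoshWeight, hpow, ← Real.exp_neg, Real.cosh_eq]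
  ring

/-- **`G_n ≤ 2φ_n`**: `liCoshWeight n t ≤ 2(cosh(n/(2t²)) − 1)`
(`log √(1 + t⁻²) = ½ log(1 + t⁻²) ≤ 1/(2t²)`, `cosh` increasing on `[0, ∞)`). -/
theorem liCoshWeight_le_two_mul_phi (n : ℕ) (t : ℝ) :
    liCoshWeight n t ≤ 2 * (Real.cosh (n / (2 * t ^ 2)) - 1) := by
  rw [liCoshWeight_eq]
  have h1 : 0 ≤ 1 + 1 / t ^ 2 := by positivity
  have hr1 : 1 ≤ Real.sqrt (1 + 1 / t ^ 2) := Real.one_le_sqrt.2 (by simpa using (by positivity : (0:ℝ) ≤ 1 / t ^ 2))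
  have hlog0 : 0 ≤ Real.log (Real.sqrt (1 + 1 / t ^ 2)) := Real.log_nonneg hr1
  have hlog : Real.log (Real.sqrt (1 + 1 / t ^ 2)) ≤ 1 / t ^ 2 / 2 := by
    rw [Real.log_sqrt h1]
    have := Real.log_le_sub_one_of_pos (show 0 < 1 + 1 / t ^ 2 by positivity)
    linarith
  have hn : (0 : ℝ) ≤ n := Nat.cast_nonneg n
  have hle : (n : ℝ) * Real.log (Real.sqrt (1 + 1 / t ^ 2)) ≤ n / (2 * t ^ 2) := by
    calc (n : ℝ) * Real.log (Real.sqrt (1 + 1 / t ^ 2)) ≤ n * (1 / t ^ 2 / 2) :=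
          mul_le_mul_of_nonneg_left hlog hn
      _ = n / (2 * t ^ 2) := by ring
  have hcosh : Real.cosh (n * Real.log (Real.sqrt (1 + 1 / t ^ 2))) ≤ Real.cosh (n / (2 * t ^ 2)) := by
    rw [Real.cosh_le_cosh, abs_of_nonneg (mul_nonneg hn hlog0), abs_of_nonneg ((mul_nonneg hn hlog0).trans hle)]
    exact hle
  linarith

/-! ### Calculus of `φ`, of the explicit count `N⁺` and of the potential `P` -/

/-- `d/dt (n/(2t²)) = −n/t³` (`t ≠ 0`). -/
theorem hasDerivAt_arg (n : ℕ) {t : ℝ} (ht : t ≠ 0) :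
    HasDerivAt (fun y : ℝ => (n : ℝ) / (2 * y ^ 2)) (-(n : ℝ) / t ^ 3) t := by
  have h := ((hasDerivAt_pow 2 t).const_mul (2 : ℝ)).inv (by positivity)
  have h' := h.const_mul (n : ℝ)
  have e : (fun y : ℝ => (n : ℝ) / (2 * y ^ 2)) = fun y => (n : ℝ) * (2 * y ^ 2)⁻¹ := by
    funext y; rw [div_eq_mul_inv]
  rw [e]
  refine h'.congr_deriv ?_
  field_simp
  ring

/-- `φ_n'(t) = −(n/t³) sinh(n/(2t²))` (`t ≠ 0`). -/
theorem hasDerivAt_phi (n : ℕ) {t : ℝ} (ht : t ≠ 0) :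
    HasDerivAt (fun y : ℝ => Real.cosh (n / (2 * y ^ 2)) - 1)
      (-((n : ℝ) / t ^ 3 * Real.sinh (n / (2 * t ^ 2)))) t := by
  have h := ((Real.hasDerivAt_cosh _).comp t (hasDerivAt_arg n ht)).sub_const 1
  refine h.congr_deriv ?_
  ring

/-- `(N⁺)'(t) = (log t − log 2π)/(2π) + 0.3083/t` (`t > 0`). -/
theorem hasDerivAt_nUp4 {t : ℝ} (ht : 0 < t) :
    HasDerivAt nUp4 ((Real.log t - Real.log (2 * π)) / (2 * π) + 0.3083 / t) t := by
  have ht0 : t ≠ 0 := ht.ne'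
  have hl : HasDerivAt Real.log t⁻¹ t := Real.hasDerivAt_log ht0
  have h := ((((hasDerivAt_id t).mul hl).div_const (2 * π)).sub
    (((hasDerivAt_id t).const_mul (1 + Real.log (2 * π))).div_const (2 * π))).add
    (hl.const_mul 0.3083) |>.add_const 4.128
  have e : nUp4 = fun y => y * Real.log y / (2 * π) - (1 + Real.log (2 * π)) * y / (2 * π)
      + 0.3083 * Real.log y + 4.128 := by
    funext y; rfl
  rw [e]
  refine h.congr_deriv ?_
  simp only [id]
  field_simp
  ring

/-- The POTENTIAL factor `P(t) = t(log(t/2π) + 1)/π + 0.3083` has `P'(t) = (log(t/2π) + 2)/π` (`t > 0`). -/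
theorem hasDerivAt_pot {t : ℝ} (ht : 0 < t) :
    HasDerivAt (fun y : ℝ => y * (Real.log (y / (2 * π)) + 1) / π + 0.3083)
      ((Real.log (t / (2 * π)) + 2) / π) t := by
  have ht0 : t ≠ 0 := ht.ne'
  have h2π : (2 * π) ≠ 0 := by positivity
  have hl : HasDerivAt (fun y => Real.log (y / (2 * π))) t⁻¹ t := by
    have := (Real.hasDerivAt_log (show t / (2 * π) ≠ 0 by positivity)).comp t
      ((hasDerivAt_id t).div_const (2 * π))
    refine this.congr_deriv ?_
    field_simp
  have h := (((hasDerivAt_id t).mul (hl.add_const 1)).div_const π).add_const 0.3083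
  refine h.congr_deriv ?_
  simp only [id]
  field_simp
  ring

/-- `P(t) ≥ 0` for `t ≥ 7` (`log(t/2π) ≥ 0`). -/
theorem pot_nonneg {t : ℝ} (ht : 7 ≤ t) : 0 ≤ t * (Real.log (t / (2 * π)) + 1) / π + 0.3083 := by
  have hπ := Real.pi_lt_d2
  have hlog : 0 ≤ Real.log (t / (2 * π)) := Real.log_nonneg (by rw [le_div_iff₀ (by positivity)]; linarith)
  positivity

/-! ### The pointwise potential inequality -/

/-- The combination `W = 2(N⁺ − c)φ + φP` and its derivative. -/
theorem hasDerivAt_W (n : ℕ) (c : ℝ) {t : ℝ} (ht : 0 < t) :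
    HasDerivAt (fun y => 2 * (nUp4 y - c) * (Real.cosh (n / (2 * y ^ 2)) - 1)
        + (Real.cosh (n / (2 * y ^ 2)) - 1) * (y * (Real.log (y / (2 * π)) + 1) / π + 0.3083))
      (2 * ((Real.log t - Real.log (2 * π)) / (2 * π) + 0.3083 / t) * (Real.cosh (n / (2 * t ^ 2)) - 1)
        + 2 * (nUp4 t - c) * -((n : ℝ) / t ^ 3 * Real.sinh (n / (2 * t ^ 2)))
        + (-((n : ℝ) / t ^ 3 * Real.sinh (n / (2 * t ^ 2))) * (t * (Real.log (t / (2 * π)) + 1) / π + 0.3083)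
          + (Real.cosh (n / (2 * t ^ 2)) - 1) * ((Real.log (t / (2 * π)) + 2) / π))) t := by
  have h1 := (((hasDerivAt_nUp4 ht).sub_const c).const_mul 2).mul (hasDerivAt_phi n ht.ne')
  have h2 := (hasDerivAt_phi n ht.ne').mul (hasDerivAt_pot ht)
  exact (h1.add h2).congr_deriv (by ring)

/-- **Pointwise potential inequality**: for `t ≥ 7` and `c ≤ d` (used with `c = N⁻(T) ≤ d = N(T)`),
`(N⁺(t) − d)·(−2φ'(t)) ≤ −W'(t)` where `W = 2(N⁺ − c)φ + φP`; the slack is `2B(u sinh u − φ) ≥ 0`,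
`u = n/(2t²)`, `B = (log(t/2π) + 1)/π + 0.3083/t`. -/
theorem pointwise_le (n : ℕ) {c d t : ℝ} (ht : 7 ≤ t) (hcd : c ≤ d) :
    (nUp4 t - d) * -(2 * -((n : ℝ) / t ^ 3 * Real.sinh (n / (2 * t ^ 2)))) ≤
      -(2 * ((Real.log t - Real.log (2 * π)) / (2 * π) + 0.3083 / t) * (Real.cosh (n / (2 * t ^ 2)) - 1)
        + 2 * (nUp4 t - c) * -((n : ℝ) / t ^ 3 * Real.sinh (n / (2 * t ^ 2)))
        + (-((n : ℝ) / t ^ 3 * Real.sinh (n / (2 * t ^ 2))) * (t * (Real.log (t / (2 * π)) + 1) / π + 0.3083)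
          + (Real.cosh (n / (2 * t ^ 2)) - 1) * ((Real.log (t / (2 * π)) + 2) / π))) := by
  have ht0 : 0 < t := by linarith
  have hπ := Real.pi_lt_d2
  set u : ℝ := (n : ℝ) / (2 * t ^ 2) with hu
  have hu0 : 0 ≤ u := by positivity
  set s : ℝ := (n : ℝ) / t ^ 3 * Real.sinh u with hs
  have hs0 : 0 ≤ s := by
    have := Real.sinh_nonneg_iff.2 hu0
    positivity
  set L : ℝ := Real.log (t / (2 * π)) with hL
  have hLeq : Real.log t - Real.log (2 * π) = L := by rw [hL, Real.log_div ht0.ne' (by positivity)]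
  have hL0 : 0 ≤ L := Real.log_nonneg (by rw [le_div_iff₀ (by positivity)]; linarith)
  set B : ℝ := (L + 1) / π + 0.3083 / t with hB
  have hB0 : 0 ≤ B := by positivity
  have hkey : (Real.cosh (n / (2 * t ^ 2)) - 1) ≤ u * Real.sinh u := cosh_sub_one_le_mul_sinh hu0
  have hphi0 : 0 ≤ (Real.cosh (n / (2 * t ^ 2)) - 1) := phi_nonneg n t
  -- `s · P(t) = 2 u sinh u · B` and `2g' + P' = 2B`
  have e1 : s * (t * (Real.log (t / (2 * π)) + 1) / π + 0.3083) = 2 * (u * Real.sinh u) * B := by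
    simp only [hs, hB, hu, ← hL]
    field_simp
  have e2 : 2 * (L / (2 * π) + 0.3083 / t) + (L + 2) / π = 2 * B := by
    simp only [hB]; field_simp; ring
  rw [hLeq]
  have hmain : (Real.cosh (n / (2 * t ^ 2)) - 1) * (2 * B) ≤ 2 * (u * Real.sinh u) * B := by nlinarith
  have hgd : (nUp4 t - d) * (2 * s) ≤ (nUp4 t - c) * (2 * s) := by nlinarith
  -- assemble
  have : (nUp4 t - d) * -(2 * -s) ≤
      -(2 * (L / (2 * π) + 0.3083 / t) * (Real.cosh (n / (2 * t ^ 2)) - 1) + 2 * (nUp4 t - c) * -s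
        + (-s * (t * (Real.log (t / (2 * π)) + 1) / π + 0.3083)
          + (Real.cosh (n / (2 * t ^ 2)) - 1) * ((L + 2) / π))) := by
    have expand : -(2 * (L / (2 * π) + 0.3083 / t) * (Real.cosh (n / (2 * t ^ 2)) - 1)
        + 2 * (nUp4 t - c) * -s
        + (-s * (t * (Real.log (t / (2 * π)) + 1) / π + 0.3083)
          + (Real.cosh (n / (2 * t ^ 2)) - 1) * ((L + 2) / π))) =
        (nUp4 t - c) * (2 * s) + (s * (t * (Real.log (t / (2 * π)) + 1) / π + 0.3083)
          - (Real.cosh (n / (2 * t ^ 2)) - 1) * (2 * (L / (2 * π) + 0.3083 / t) + (L + 2) / π)) := by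
      ring
    rw [expand, e2, e1]
    nlinarith
  simpa [hs, hu] using this

end CoshTail

open CoshTail

/-- **Crux `LiCoshTailCount` (deciding; RH-FREE zero counting).**  For `1000 ≤ T ≤ U` and every `n`,
`∑_{T < Im ρ ≤ U} m(ρ) liCoshWeight n (Im ρ) ≤ liCoshTail n T`: partial summation of the decreasing majorant
`2(cosh(n/2t²) − 1)` against the explicit two-sided zero count `|N(t) − (t/2π) log(t/2πe)| ≤ 0.3083 log t + 4.128`
(Backlund–Trudgian), closed by the potential `W = 2(N⁺ − N⁻(T))φ + φP` (`cosh u − 1 ≤ u sinh u`); the value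
`W(T) = φ(T)[T(log(T/2π) + 1)/π + 1.2332 log T + 16.8203]` sits inside `liCoshTail n T`. -/
theorem sum_liCoshWeight_le_liCoshTail :
    ∀ (n : ℕ) (T U : ℝ), 1000 ≤ T → T ≤ U →
      ∑ ρ ∈ Literature.NumberTheory.LFunctions.SchoenfeldBound.zerosBetween T U,
          (Literature.NumberTheory.LFunctions.riemannZetaZeroOrder ρ : ℝ) * liCoshWeight n ρ.im
        ≤ liCoshTail n T := by
  intro n T U hT hU
  have hT0 : 0 < T := by linarith
  have hπ := Real.pi_pos
  -- Step 1: `G_n ≤ 2φ` termwise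
  have hsum : ∑ ρ ∈ zerosBetween T U, (riemannZetaZeroOrder ρ : ℝ) * liCoshWeight n ρ.im ≤
      ∑ ρ ∈ zerosBetween T U,
        (riemannZetaZeroOrder ρ : ℝ) * (fun t => 2 * (Real.cosh (n / (2 * t ^ 2)) - 1)) ρ.im :=
    Finset.sum_le_sum fun ρ hρ ↦
      mul_le_mul_of_nonneg_left (liCoshWeight_le_two_mul_phi n ρ.im)
        (zeroOrder_nonneg_of_mem_zerosBetween hT0.le hρ)
  -- Step 2: partial summation with `f = 2φ`, `N ≤ N⁺` on `[T, U]`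
  have h := sum_zerosBetween_le_of_count_le (T₁ := T) (T₂ := U) hT0.le hU
    (f := fun t ↦ 2 * (Real.cosh (n / (2 * t ^ 2)) - 1))
    (f' := fun t ↦ 2 * -((n : ℝ) / t ^ 3 * Real.sinh (n / (2 * t ^ 2)))) (Nup := nUp4)
    (fun t ht ↦ (hasDerivAt_phi n (by linarith [ht.1] : t ≠ 0)).const_mul 2)
    (continuousOn_of_forall_continuousAt fun t ht ↦ by
      have h0 : t ≠ 0 := by linarith [ht.1]
      have h3 : t ^ 3 ≠ 0 := pow_ne_zero 3 h0
      have h2 : 2 * t ^ 2 ≠ 0 := by positivity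
      fun_prop (disch := assumption))
    (fun t ht ↦ by
      have : 0 < t := by linarith [ht.1]
      have : 0 ≤ Real.sinh (n / (2 * t ^ 2)) := Real.sinh_nonneg_iff.2 (by positivity)
      have : 0 ≤ (n : ℝ) / t ^ 3 * Real.sinh (n / (2 * t ^ 2)) := by positivity
      linarith)
    (by have := phi_nonneg n U; positivity)
    (fun t ht ↦ count_le_nUp4 (by linarith [ht.1])) (continuousOn_nUp4 hT0)
  -- Step 3: the potential `W`
  have hN := nLo4_le_count (t := T) (by linarith)
  set c := nLo4 T with hc
  have hW : ∀ t ∈ uIcc T U, HasDerivAt (fun y => 2 * (nUp4 y - c) * (Real.cosh (n / (2 * y ^ 2)) - 1)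
      + (Real.cosh (n / (2 * y ^ 2)) - 1) * (y * (Real.log (y / (2 * π)) + 1) / π + 0.3083)) _ t :=
    fun t ht ↦ by
      rw [uIcc_of_le hU] at ht
      exact hasDerivAt_W n c (by linarith [ht.1])
  have hcontW' : ContinuousOn (fun t =>
      2 * ((Real.log t - Real.log (2 * π)) / (2 * π) + 0.3083 / t) * (Real.cosh (n / (2 * t ^ 2)) - 1)
        + 2 * (nUp4 t - c) * -((n : ℝ) / t ^ 3 * Real.sinh (n / (2 * t ^ 2)))
        + (-((n : ℝ) / t ^ 3 * Real.sinh (n / (2 * t ^ 2))) * (t * (Real.log (t / (2 * π)) + 1) / π + 0.3083)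
          + (Real.cosh (n / (2 * t ^ 2)) - 1) * ((Real.log (t / (2 * π)) + 2) / π))) (Icc T U) :=
    continuousOn_of_forall_continuousAt fun t ht ↦ by
      have h0 : t ≠ 0 := by linarith [ht.1]
      have h3 : t ^ 3 ≠ 0 := pow_ne_zero 3 h0
      have h2 : 2 * t ^ 2 ≠ 0 := by positivity
      have h2π : t / (2 * π) ≠ 0 := by positivity
      have hc1 := continuousAt_nUp4 h0
      fun_prop (disch := assumption)
  have hFTC := integral_eq_sub_of_hasDerivAt hW (hcontW'.intervalIntegrable_of_Icc hU)
  -- Step 4: compare the integrands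
  have hcontL : ContinuousOn (fun t => (nUp4 t - zetaZeroCount T) *
      -((fun t ↦ 2 * -((n : ℝ) / t ^ 3 * Real.sinh (n / (2 * t ^ 2)))) t)) (Icc T U) :=
    continuousOn_of_forall_continuousAt fun t ht ↦ by
      have h0 : t ≠ 0 := by linarith [ht.1]
      have h3 : t ^ 3 ≠ 0 := pow_ne_zero 3 h0
      have h2 : 2 * t ^ 2 ≠ 0 := by positivity
      have hc1 := continuousAt_nUp4 h0
      fun_prop (disch := assumption)
  have hint_le : ∫ t in T..U, (nUp4 t - zetaZeroCount T) *
      -((fun t ↦ 2 * -((n : ℝ) / t ^ 3 * Real.sinh (n / (2 * t ^ 2)))) t) ≤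
      ∫ t in T..U,
        -(2 * ((Real.log t - Real.log (2 * π)) / (2 * π) + 0.3083 / t) * (Real.cosh (n / (2 * t ^ 2)) - 1)
        + 2 * (nUp4 t - c) * -((n : ℝ) / t ^ 3 * Real.sinh (n / (2 * t ^ 2)))
        + (-((n : ℝ) / t ^ 3 * Real.sinh (n / (2 * t ^ 2))) * (t * (Real.log (t / (2 * π)) + 1) / π + 0.3083)
          + (Real.cosh (n / (2 * t ^ 2)) - 1) * ((Real.log (t / (2 * π)) + 2) / π))) := by
    refine integral_mono_on hU (hcontL.intervalIntegrable_of_Icc hU)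
      (hcontW'.neg.intervalIntegrable_of_Icc hU) fun t ht ↦ ?_
    exact pointwise_le n (by linarith [ht.1]) hN
  rw [intervalIntegral.integral_neg, hFTC] at hint_le
  -- Step 5: values of `W` at `T` and `U`
  have hWU : (nUp4 U - zetaZeroCount T) * (2 * (Real.cosh (n / (2 * U ^ 2)) - 1)) ≤
      2 * (nUp4 U - c) * (Real.cosh (n / (2 * U ^ 2)) - 1)
        + (Real.cosh (n / (2 * U ^ 2)) - 1) * (U * (Real.log (U / (2 * π)) + 1) / π + 0.3083) := by
    have h1 : 0 ≤ (Real.cosh (n / (2 * U ^ 2)) - 1) := phi_nonneg n U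
    have h2 : 0 ≤ (U * (Real.log (U / (2 * π)) + 1) / π + 0.3083) := pot_nonneg (by linarith)
    nlinarith
  have hWT : 2 * (nUp4 T - c) * (Real.cosh (n / (2 * T ^ 2)) - 1)
      + (Real.cosh (n / (2 * T ^ 2)) - 1) * (T * (Real.log (T / (2 * π)) + 1) / π + 0.3083) ≤ liCoshTail n T := by
    have hgT : nUp4 T - c = 2 * (0.3083 * Real.log T + 4.128) := by
      simp only [hc, nUp4, nLo4]; ring
    rw [hgT]
    have hlog : 0 ≤ Real.log T := Real.log_nonneg (by linarith)
    have hφ : 0 ≤ (Real.cosh (n / (2 * T ^ 2)) - 1) := phi_nonneg n T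
    unfold liCoshTail
    nlinarith [mul_nonneg hφ hlog]
  linarith [hsum, h, hint_le, hWU, hWT]

/-- **BC5 rung** (the crux restricted to `n ≤ (4/5)T²`, a corollary of the full count). -/
theorem sum_liCoshWeight_le_liCoshTail_quadRange :
    ∀ (n : ℕ) (T U : ℝ), 1000 ≤ T → T ≤ U → (n : ℝ) ≤ 4 / 5 * T ^ 2 →
      ∑ ρ ∈ Literature.NumberTheory.LFunctions.SchoenfeldBound.zerosBetween T U,
          (Literature.NumberTheory.LFunctions.riemannZetaZeroOrder ρ : ℝ) * liCoshWeight n ρ.im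
        ≤ liCoshTail n T :=
  fun n T U hT hU _ ↦ sum_liCoshWeight_le_liCoshTail n T U hT hU

end Summit.RiemannHypothesis.RiemannHypothesis.Theorems.LiTheory

end
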